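import Literature.NumberTheory.EllipticCurves.SigmaSqDivisionBridgeProofs
import Literature.NumberTheory.EllipticCurves.SigmaSqDivisionOfThetaProofs
import Literature.NumberTheory.EllipticCurves.FormalGroupLawPadicProofs
import HarnessLib

/-!
# The SQUARED Mazur–Tate theta relation on points of the kernel of reduction, for the
# sigma-squared function `Σ_p = padicSigmaSq` — at every good ordinary prime including `p = 2`
# (proofs only)

Trunk T-NT-EC (`Literature/NumberTheory/EllipticCurves`). Pure proof file (no definitions, no named
facts), sequel of `SigmaSqDivisionBridgeProofs.lean` (`IsMazurTateSigmaSqPair.thetaSq_formal`: the squared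
theta relation `Σ(u +_F v)Σ(u -_F v)u⁴v⁴ = (u²X(v) - v²X(u))²Σ(u)²Σ(v)²` in `ℚ_p⟦u, v⟧` for a sigma-squared
pair) and the `Σ`-twin of the tree's `padicSigma_theta_of_formal` (`CanonicalPAdicHeightThetaProofs.lean`,
which does this for `σ_p` at `p ≥ 5`). Typer seat `bsd-goldfeld-ty` g9 of the cell `bsd-goldfeld`
(memo `TY-HYPOTHESES-AT-TWO.md` §11), in support of stmt-BirchSwinnertonDyer-19141: this is the first
step («property IV of `σ`», Mazur–Stein–Tate 2006 §2.7) of the parallelogram law for the sigma-SQUARED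
height `canonicalPAdicHeightSq W p P = log_p den x(P) − log_p Σ_p(z(P))` (`PadicSigmaSq.lean`), the
receptacle in which `p = 2` height facts are typed.

* (private) `padicEval₂_thetaSqLHS`, `padicEval₂_thetaSqRHS` — evaluation of the two (integral) sides at a pair
  of points of the open unit disc;
* `padicSigmaSqEval_theta_of_exists` — **for `W/ℚ` elliptic with `ℤ`-integral equation, ANY prime `p`
  at which `W ⊗ ℚ_p` has a sigma-squared pair, and `P = (x₁, y₁)`, `Q = (x₂, y₂) ∈ E(ℚ) ∩ E₁(ℚ_p)`:
  `Σ_p(z(P+Q))·Σ_p(z(P−Q)) = (x₂ − x₁)²·Σ_p(z(P))²·Σ_p(z(Q))²`** — evaluate the formal identity at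
  `(z(P), z(Q))`, read `F̂(z P, z Q) = z(P+Q)`, `F̂(z P, î(z Q)) = z(P−Q)` (the tree's theorem
  `formalGroupLaw_padicEval_holds`), `X̂(z P) = x₁·z(P)²`, and cancel `z(P)⁴z(Q)⁴ ≠ 0`;
* `padicSigmaSqEval_theta_two` — the case `p = 2`: `W` globally minimal with good ORDINARY reduction
  at `2`, under the printed fact `mazurTate_sigmaSq_existsUnique_two` (Silverman 2005 §5 Rem. 2), via
  `exists_isMazurTateSigmaSqPair_two`.

## Sources

* [MazurTate1991] B. Mazur, J. Tate, Duke Math. J. 62 (1991), Thm. 3.1 (the theta relation characterises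
  `σ`; squared it characterises `σ²`).
* [BlakestadGrant2023] C. Blakestad, D. Grant, J. Number Theory 249 (2023), Prop. 14, Thm. 15
  (specialisation of the formal identity at points).
* [MazurSteinTate2006] B. Mazur, W. Stein, J. Tate, Doc. Math. Extra Vol. (2006), §2.7 (property IV).
* [Silverman2005DivPoly] J. H. Silverman, Math. Ann. 332 (2005), §5 Rem. 2.

## Design notes

Proofs only. The hypotheses are `p`-generic («a sigma-squared pair of `W ⊗ ℚ_p` exists»): at odd good
ordinary `p ≥ 5` this is `IsMazurTateSigmaPair.sq` of the Mazur–Tate pair, at `p = 2` it is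
`exists_isMazurTateSigmaSqPair_two`.
-/

noncomputable section

open scoped Classical
open PowerSeries Literature.NumberTheory.EllipticCurves

namespace WeierstrassCurve

/-! ### Evaluating the two sides of the squared theta relation -/

section Eval

variable {p : ℕ} [Fact p.Prime] (V : WeierstrassCurve ℚ_[p]) [hV : V.IsIntegral ℤ_[p]]

variable {V} in
/-- **Value of the left side**: `(Σ(F)·Σ(u -_F v)·u⁴·v⁴)(u, v) = Σ̂(F̂(u,v))·Σ̂(F̂(u, î(v)))·u⁴·v⁴`
for `Σ ∈ ℤ_p⟦z⟧` and `‖u‖, ‖v‖ < 1`. [Blakestad–Grant 2023, Thm. 15 (specialisation)] [folklore] -/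
private theorem padicEval₂_thetaSqLHS {Sq : ℚ_[p]⟦X⟧} (hSq : IsPadicInt Sq) {u v : ℚ_[p]} (hu : ‖u‖ < 1)
    (hv : ‖v‖ < 1) :
    padicEval₂ (Sq.subst V.formalGroupLaw * Sq.subst V.formalGroupLawSub *
        (MvPowerSeries.X 0 : MvPowerSeries (Fin 2) ℚ_[p]) ^ 4 * (MvPowerSeries.X 1) ^ 4) u v =
      padicEval Sq (padicEval₂ V.formalGroupLaw u v) *
        padicEval Sq (padicEval₂ V.formalGroupLaw u (padicEval V.formalNeg v)) * u ^ 4 * v ^ 4 := by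
  have hF := V.isPadicInt_formalGroupLaw
  have h1 := hSq.powerSeries_subst hF V.hasSubst_formalGroupLaw
  have hFs := V.isPadicInt_formalGroupLawSub
  have h2 := hSq.powerSeries_subst hFs
    (PowerSeries.HasSubst.of_constantCoeff_zero V.constantCoeff_formalGroupLawSub)
  have hX0 : IsPadicInt ((MvPowerSeries.X 0 : MvPowerSeries (Fin 2) ℚ_[p]) ^ 4) := (IsPadicInt.X 0).pow 4
  have hX1 : IsPadicInt ((MvPowerSeries.X 1 : MvPowerSeries (Fin 2) ℚ_[p]) ^ 4) := (IsPadicInt.X 1).pow 4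
  rw [padicEval₂_mul ((h1.mul h2).mul hX0) hX1 hu hv, padicEval₂_mul (h1.mul h2) hX0 hu hv,
    padicEval₂_mul h1 h2 hu hv, padicEval₂_pow (IsPadicInt.X 0) hu hv, padicEval₂_pow (IsPadicInt.X 1) hu hv,
    padicEval₂_X, padicEval₂_X, padicEval₂_subst hSq hF V.constantCoeff_formalGroupLaw hu hv,
    padicEval₂_subst hSq hFs V.constantCoeff_formalGroupLawSub hu hv]
  unfold formalGroupLawSub
  rw [padicEval₂_substPair hF (IsPadicInt.X 0) (V.isPadicInt_formalNeg.powerSeries_subst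
      (IsPadicInt.X 1) (PowerSeries.HasSubst.X 1)) (MvPowerSeries.constantCoeff_X 0)
      (V.constantCoeff_formalNeg_subst_X 1) hu hv,
    padicEval₂_X, padicEval₂_subst_X V.isPadicInt_formalNeg hu hv]
  rfl

variable {V} in
/-- **Value of the right side**: `((u²X(v) - v²X(u))²·Σ(u)²·Σ(v)²)(u, v) =
(u²X̂(v) - v²X̂(u))²·Σ̂(u)²·Σ̂(v)²`. [folklore] -/
private theorem padicEval₂_thetaSqRHS {Sq : ℚ_[p]⟦X⟧} (hSq : IsPadicInt Sq) {u v : ℚ_[p]} (hu : ‖u‖ < 1)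
    (hv : ‖v‖ < 1) :
    padicEval₂ (((MvPowerSeries.X 0 : MvPowerSeries (Fin 2) ℚ_[p]) ^ 2 *
          V.formalXMulSq.subst (MvPowerSeries.X 1 : MvPowerSeries (Fin 2) ℚ_[p]) -
          (MvPowerSeries.X 1) ^ 2 * V.formalXMulSq.subst (MvPowerSeries.X 0 : MvPowerSeries (Fin 2) ℚ_[p])) ^ 2 *
        Sq.subst (MvPowerSeries.X 0 : MvPowerSeries (Fin 2) ℚ_[p]) ^ 2 *
        Sq.subst (MvPowerSeries.X 1 : MvPowerSeries (Fin 2) ℚ_[p]) ^ 2) u v =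
      (u ^ 2 * padicEval V.formalXMulSq v - v ^ 2 * padicEval V.formalXMulSq u) ^ 2 *
        padicEval Sq u ^ 2 * padicEval Sq v ^ 2 := by
  have hXs0 := V.isPadicInt_formalXMulSq.powerSeries_subst (IsPadicInt.X (0 : Fin 2))
    (PowerSeries.HasSubst.X 0)
  have hXs1 := V.isPadicInt_formalXMulSq.powerSeries_subst (IsPadicInt.X (1 : Fin 2))
    (PowerSeries.HasSubst.X 1)
  have hs0 := hSq.powerSeries_subst (IsPadicInt.X (0 : Fin 2)) (PowerSeries.HasSubst.X 0)
  have hs1 := hSq.powerSeries_subst (IsPadicInt.X (1 : Fin 2)) (PowerSeries.HasSubst.X 1)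
  have hX0 : IsPadicInt ((MvPowerSeries.X 0 : MvPowerSeries (Fin 2) ℚ_[p]) ^ 2) := (IsPadicInt.X 0).pow 2
  have hX1 : IsPadicInt ((MvPowerSeries.X 1 : MvPowerSeries (Fin 2) ℚ_[p]) ^ 2) := (IsPadicInt.X 1).pow 2
  have hd := (hX0.mul hXs1).sub (hX1.mul hXs0)
  rw [padicEval₂_mul ((hd.pow 2).mul (hs0.pow 2)) (hs1.pow 2) hu hv, padicEval₂_mul (hd.pow 2) (hs0.pow 2) hu hv,
    padicEval₂_pow hd hu hv, padicEval₂_sub (hX0.mul hXs1) (hX1.mul hXs0) hu hv, padicEval₂_mul hX0 hXs1 hu hv,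
    padicEval₂_mul hX1 hXs0 hu hv, padicEval₂_pow hs0 hu hv, padicEval₂_pow hs1 hu hv,
    padicEval₂_pow (IsPadicInt.X 0) hu hv, padicEval₂_pow (IsPadicInt.X 1) hu hv, padicEval₂_X,
    padicEval₂_X, padicEval₂_subst_X V.isPadicInt_formalXMulSq hu hv,
    padicEval₂_subst_X V.isPadicInt_formalXMulSq hu hv, padicEval₂_subst_X hSq hu hv,
    padicEval₂_subst_X hSq hu hv]
  rfl

end Eval

/-! ### The squared theta relation at rational points of the kernel of reduction -/

section Points

variable (W : WeierstrassCurve ℚ) [W.IsElliptic] [W.IsIntegral ℤ] (p : ℕ) [Fact p.Prime]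

/-- **The squared Mazur–Tate theta relation at points** («property IV» for `Σ_p = σ_p²`): for `W/ℚ`
elliptic with `ℤ`-integral equation, a prime `p` at which `W ⊗ ℚ_p` has a sigma-squared pair (so that
`padicSigmaSq` is one), and `P = (x₁, y₁)`, `Q = (x₂, y₂) ∈ E(ℚ)` with `‖x₁‖_p, ‖x₂‖_p > 1`:
`Σ_p(z(P+Q))·Σ_p(z(P−Q)) = (x₂ − x₁)²·Σ_p(z(P))²·Σ_p(z(Q))²` — the square of
`σ(u +_E v)σ(u -_E v)/(σ(u)²σ(v)²) = x(v) − x(u)`, valid also at `p = 2` where only `σ²` exists.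
Proof: evaluate `IsMazurTateSigmaSqPair.thetaSq_formal` at `(z(P), z(Q))`, read the formal group law on
points (`formalGroupLaw_padicEval_holds`) and `X̂(z P) = x₁z(P)²`, cancel `z(P)⁴z(Q)⁴`.
[Mazur–Tate 1991, Thm. 3.1; Blakestad–Grant 2023, Prop. 14 and Thm. 15; Mazur–Stein–Tate 2006, §2.7]
[cite: BlakestadGrant2023, Thm. 15] [cite: MazurTate1991, Thm. 3.1] -/
theorem padicSigmaSqEval_theta_of_exists
    (hex : ∃ Sq : ℚ_[p]⟦X⟧, ∃ c : ℚ_[p], (W.baseChange ℚ_[p]).IsMazurTateSigmaSqPair Sq c)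
    {x₁ y₁ x₂ y₂ : ℚ} (h₁ : W.toAffine.Nonsingular x₁ y₁) (h₂ : W.toAffine.Nonsingular x₂ y₂)
    (hx₁ : 1 < ‖(x₁ : ℚ_[p])‖) (hx₂ : 1 < ‖(x₂ : ℚ_[p])‖) :
    W.padicSigmaSqEval p (W.padicParam p (.some x₁ y₁ h₁ + .some x₂ y₂ h₂)) *
        W.padicSigmaSqEval p (W.padicParam p (.some x₁ y₁ h₁ - .some x₂ y₂ h₂)) =
      ((x₂ : ℚ_[p]) - x₁) ^ 2 * W.padicSigmaSqEval p (W.padicParam p (.some x₁ y₁ h₁)) ^ 2 *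
        W.padicSigmaSqEval p (W.padicParam p (.some x₂ y₂ h₂)) ^ 2 := by
  set V := W.baseChange ℚ_[p] with hVdef
  have hpair : V.IsMazurTateSigmaSqPair V.padicSigmaSq V.padicSigmaSqConst :=
    isMazurTateSigmaSqPair_padicSigmaSq (Or.inr hex)
  have hint : IsPadicInt V.padicSigmaSq := hpair.isPadicInt
  -- the formal squared theta relation and the formal group law on points
  have hΘ := hpair.thetaSq_formal
  have hFadd := formalGroupLaw_padicEval_holds p V
  -- the points over `ℚ_p`
  set ι := W.toPadicPoint p with hιdef
  set P : W.toAffine.Point := .some x₁ y₁ h₁ with hPdef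
  set Q : W.toAffine.Point := .some x₂ y₂ h₂ with hQdef
  have hιP : ι P = .some (x₁ : ℚ_[p]) (y₁ : ℚ_[p]) (nonsingular_ratCast h₁) := toPadicPoint_some h₁
  have hιQ : ι Q = .some (x₂ : ℚ_[p]) (y₂ : ℚ_[p]) (nonsingular_ratCast h₂) := toPadicPoint_some h₂
  have hιnQ : ι (-Q) = .some (x₂ : ℚ_[p]) (V.toAffine.negY (x₂ : ℚ_[p]) (y₂ : ℚ_[p]))
      ((Affine.nonsingular_neg ..).mpr (nonsingular_ratCast h₂)) := by
    rw [map_neg, hιQ, Affine.Point.neg_some]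
  have hkP : V.IsInReductionKernel (ι P) := by rw [hιP]; exact hx₁
  have hkQ : V.IsInReductionKernel (ι Q) := by rw [hιQ]; exact hx₂
  have hknQ : V.IsInReductionKernel (ι (-Q)) := by rw [hιnQ]; exact hx₂
  -- parameters
  obtain ⟨hy₁, hu0, hu1, -, -⟩ := V.param_facts (nonsingular_ratCast (p := p) h₁).1 hx₁
  obtain ⟨hy₂, hv0, hv1, -, -⟩ := V.param_facts (nonsingular_ratCast (p := p) h₂).1 hx₂
  set u : ℚ_[p] := -(x₁ : ℚ_[p]) / y₁ with hudef
  set v : ℚ_[p] := -(x₂ : ℚ_[p]) / y₂ with hvdef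
  have hzP : V.formalParameter (ι P) = u := by rw [hιP]; rfl
  have hzQ : V.formalParameter (ι Q) = v := by rw [hιQ]; rfl
  have hznQ : V.formalParameter (ι (-Q)) = padicEval V.formalNeg v := by
    rw [hιnQ, V.padicEval_formalNeg_eq (nonsingular_ratCast (p := p) h₂).1 hx₂]; rfl
  -- the formal group law at `(P, Q)` and `(P, -Q)`
  have hadd : padicEval₂ V.formalGroupLaw u v = W.padicParam p (P + Q) := by
    rw [← hzP, ← hzQ, hFadd _ _ hkP hkQ, ← map_add, formalParameter_toPadicPoint]
  have hsub : padicEval₂ V.formalGroupLaw u (padicEval V.formalNeg v) = W.padicParam p (P - Q) := by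
    rw [← hzP, ← hznQ, hFadd _ _ hkP hknQ, ← map_add, ← sub_eq_add_neg, formalParameter_toPadicPoint]
  -- the dictionary for `X = z²x`
  have hXu : padicEval V.formalXMulSq u = (x₁ : ℚ_[p]) * u ^ 2 :=
    V.padicEval_formalXMulSq_eq (nonsingular_ratCast (p := p) h₁).1 hx₁
  have hXv : padicEval V.formalXMulSq v = (x₂ : ℚ_[p]) * v ^ 2 :=
    V.padicEval_formalXMulSq_eq (nonsingular_ratCast (p := p) h₂).1 hx₂
  -- evaluate the formal identity at `(u, v)`
  have key := congrArg (fun G => padicEval₂ G u v) hΘ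
  rw [padicEval₂_thetaSqLHS hint hu1 hv1, padicEval₂_thetaSqRHS hint hu1 hv1, hadd, hsub, hXu, hXv] at key
  -- read the sigma-squared values and cancel `u⁴ v⁴`
  simp only [padicSigmaSqEval]
  rw [show W.padicParam p P = u from rfl, show W.padicParam p Q = v from rfl]
  have huv : u ^ 4 * v ^ 4 ≠ 0 := mul_ne_zero (pow_ne_zero 4 hu0) (pow_ne_zero 4 hv0)
  apply mul_right_cancel₀ huv
  linear_combination key

/-- **The squared theta relation at `p = 2`**: for `W/ℚ` globally minimal with good ORDINARY reduction at
`2` and `P, Q ∈ E(ℚ) ∩ E₁(ℚ₂)`, under the printed fact `mazurTate_sigmaSq_existsUnique_two` (Silverman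
2005 §5 Rem. 2, which supplies the sigma-squared pair through `exists_isMazurTateSigmaSqPair_two`):
`Σ₂(z(P+Q))·Σ₂(z(P−Q)) = (x₂ − x₁)²·Σ₂(z(P))²·Σ₂(z(Q))²`. [Mazur–Tate 1991, Thm. 3.1; Silverman 2005,
§5 Rem. 2; Mazur–Stein–Tate 2006, §2.7] [cite: Silverman2005DivPoly, §5 Rem. 2]
[cite: MazurTate1991, Thm. 3.1] -/
theorem padicSigmaSqEval_theta_two (hMT : mazurTate_sigmaSq_existsUnique_two) (W : WeierstrassCurve ℚ)
    [W.IsElliptic] [W.IsGloballyMinimal] (hgood : W.HasGoodReductionAtPrime 2)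
    (hord : ¬ (2 : ℤ) ∣ W.frobeniusTrace 2) {x₁ y₁ x₂ y₂ : ℚ} (h₁ : W.toAffine.Nonsingular x₁ y₁)
    (h₂ : W.toAffine.Nonsingular x₂ y₂) (hx₁ : 1 < ‖(x₁ : ℚ_[2])‖) (hx₂ : 1 < ‖(x₂ : ℚ_[2])‖) :
    W.padicSigmaSqEval 2 (W.padicParam 2 (.some x₁ y₁ h₁ + .some x₂ y₂ h₂)) *
        W.padicSigmaSqEval 2 (W.padicParam 2 (.some x₁ y₁ h₁ - .some x₂ y₂ h₂)) =
      ((x₂ : ℚ_[2]) - x₁) ^ 2 * W.padicSigmaSqEval 2 (W.padicParam 2 (.some x₁ y₁ h₁)) ^ 2 *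
        W.padicSigmaSqEval 2 (W.padicParam 2 (.some x₂ y₂ h₂)) ^ 2 :=
  W.padicSigmaSqEval_theta_of_exists 2 (W.exists_isMazurTateSigmaSqPair_two hMT hgood hord) h₁ h₂ hx₁ hx₂

end Points

end WeierstrassCurve

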